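import Mathlib.LinearAlgebra.PiTensorProduct.Basis
import Mathlib.LinearAlgebra.Trace
import HarnessLib

/-!
# The trace of a tensor product of endomorphisms over a finite index type: `tr (⊗ᵢ fᵢ) = ∏ᵢ tr fᵢ`

Topic `LinearAlgebra`; namespace `Literature.LinearAlgebra`.  Mathlib proves the binary case
`LinearMap.trace_tensorProduct'` (`tr (f ⊗ g) = tr f · tr g`); this file proves the finite-family case for Mathlib's
`PiTensorProduct` (`⨂[R] i, M i`, `PiTensorProduct.map f`), over a commutative ring and finite free modules, by computing
the trace in the tensor basis `Basis.piTensorProduct` (Mathlib) whose coordinates of a pure tensor are the products of the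
coordinates (`Basis.piTensorProduct_repr_tprod_apply`), and exchanging `∑` and `∏` (`Finset.prod_univ_sum`).
Consumer (cell `hodgecm-mathlib`, F0∕P3 road «TF», brick (P1)): the trace of a pure-tensor Hecke operator on the box-level
invariants of a restricted tensor product of admissible representations is the product of the local traces.
Theorems only; no `sorry`; Mathlib-only imports.

## References
* N. Bourbaki, *Algebra I*, Ch. II §4.4 and Ch. III §9 (trace of a tensor product of endomorphisms) [BourbakiAlgebraI1989].
* D. Bump, *Automorphic Forms and Representations* (1997), §3.4 (restricted tensor products; the use) [Bump1997].
-/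

namespace Literature.LinearAlgebra

open scoped TensorProduct
open PiTensorProduct

universe u v w

variable {ι : Type u} {R : Type v} {M : ι → Type w} [Fintype ι] [CommRing R] [∀ i, AddCommGroup (M i)]
  [∀ i, Module R (M i)]

/-- **The trace in a tensor basis**: for bases `b i` of the `M i` (finite index types) and endomorphisms `f i`,
`tr (PiTensorProduct.map f) = ∏ i, tr (f i)` — both sides computed as matrix traces in the bases `Basis.piTensorProduct b`
and `b i`. [cite: BourbakiAlgebraI1989, Ch. II §4.4] -/
theorem trace_piTensorProduct_map_of_basis {κ : ι → Type*} [∀ i, Fintype (κ i)] [∀ i, DecidableEq (κ i)]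
    (b : ∀ i, Module.Basis (κ i) R (M i)) (f : ∀ i, M i →ₗ[R] M i) :
    LinearMap.trace R (⨂[R] i, M i) (PiTensorProduct.map f) = ∏ i, LinearMap.trace R (M i) (f i) := by
  classical
  rw [LinearMap.trace_eq_matrix_trace R (Basis.piTensorProduct b)]
  simp_rw [LinearMap.trace_eq_matrix_trace R (b _)]
  simp only [Matrix.trace, Matrix.diag_apply, LinearMap.toMatrix_apply, Basis.piTensorProduct_apply,
    PiTensorProduct.map_tprod, Basis.piTensorProduct_repr_tprod_apply]
  rw [Finset.prod_univ_sum]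
  simp only [Fintype.piFinset_univ]

/-- **`tr (⊗ᵢ fᵢ) = ∏ᵢ tr fᵢ`** for endomorphisms `f i` of finite free modules `M i` over a commutative ring, `i` ranging over a
finite type (the finite-family form of Mathlib's `LinearMap.trace_tensorProduct'`). [cite: BourbakiAlgebraI1989, Ch. II §4.4] -/
theorem trace_piTensorProduct_map [∀ i, Module.Free R (M i)] [∀ i, Module.Finite R (M i)]
    (f : ∀ i, M i →ₗ[R] M i) :
    LinearMap.trace R (⨂[R] i, M i) (PiTensorProduct.map f) = ∏ i, LinearMap.trace R (M i) (f i) := by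
  classical
  exact trace_piTensorProduct_map_of_basis (fun i => Module.Free.chooseBasis R (M i)) f

/-- **Restriction to invariant submodules**: if each `f i` preserves a submodule `N i` of a module `M i` and the `N i` are finite
free, the trace of `⊗ᵢ (fᵢ|_{Nᵢ})` on `⨂ᵢ Nᵢ` is `∏ᵢ tr (fᵢ|_{Nᵢ})` (the form used on box-level invariants `⨂ᵢ Vᵢ^{Lᵢ}`).
[cite: BourbakiAlgebraI1989, Ch. II §4.4] -/
theorem trace_piTensorProduct_map_restrict (N : ∀ i, Submodule R (M i)) [∀ i, Module.Free R (N i)]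
    [∀ i, Module.Finite R (N i)] (f : ∀ i, M i →ₗ[R] M i) (hf : ∀ i, ∀ x ∈ N i, f i x ∈ N i) :
    LinearMap.trace R (⨂[R] i, N i) (PiTensorProduct.map fun i => (f i).restrict (hf i)) =
      ∏ i, LinearMap.trace R (N i) ((f i).restrict (hf i)) :=
  trace_piTensorProduct_map _

end Literature.LinearAlgebra
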